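import Mathlib
import Literature.Analysis.FluidPDE.UniversalTotalAnomalousDissipator
import HarnessLib

/-!
# Rowan (2024): accelerated relaxation-enhancing flows cause total dissipation (Theorem 1.6)

Named fact (Literature is sorry-free; users take `(h : Rowan2024_thm16)`).

Source: K. Rowan, *Accelerated relaxation enhancing flows cause total dissipation*, Nonlinearity 37
(2024), no. 9, 095010 = arXiv:2401.15001v1 (26 Jan 2024; 6 pp., same numbering) [cite: Rowan2024].
Statements (arXiv PDF pages):

* **Definition 1.2** (p. 1): for a flow `u ∈ L^∞_loc([0,∞) × T^d)` with `∇·u = 0`, a diffusivity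
  `ν > 0` and times `0 ≤ s ≤ t < ∞`, `Φ^{u,ν}_{s,t} : L²₀(T^d) → L²₀(T^d)` is the solution operator of
  `∂ₜθ - νΔθ + u·∇θ = 0` (1.1) from time `s` to time `t` (`L²₀` = mean-zero `L²`, Def. 1.1).
* **Definition 1.3** (p. 1): the dissipation time
  `τ^u(ν) := sup_{s ≥ 0} ( inf { t - s : t ≥ s, ‖Φ^{u,ν}_{s,t}‖_{L²₀→L²₀} ≤ 1/2 } )`.
* **Definition 1.4** (p. 1): `u` is *relaxation enhancing* if `lim_{ν→0} ν τ^u(ν) = 0`.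
* **Definition 1.5** (p. 2): for an increasing diffeomorphism `σ : [0,1) → [0,∞)`, the accelerated
  flow is `u_σ(t,x) := σ'(t) u(σ(t), x)` on `[0,1) × T^d` ("if `θ` solves the transport equation
  associated to `u`, then `θ(σ(t),x)` solves the transport equation associated to `u_σ`").
* **Theorem 1.6** (p. 2): "Suppose that `u ∈ L^∞_loc([0,∞) × T^d)` such that `∇·u = 0` is
  relaxation enhancing. Then there exists some acceleration of `u` that is totally diffusive on
  `[0,1]` for all diffusivities `ν > 0`, that is there exists some smooth diffeomorphism
  `σ : [0,1) → [0,∞)` such that for all `ν > 0`, `s ∈ [0,1)`, `θ₀ ∈ L²₀(T^d)`,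
  `Φ^{u_σ,ν}_{s,1} θ₀ = 0`."
* Proof (§3, p. 4): `σ` is built so that for every `ν > 0` and all large `j`,
  `‖Φ^{u_σ,ν}_{1-2^{-(j-1)}, 1-2^{-(j-1)}+2^{-(j+1)}}‖_{L²₀→L²₀} ≤ 1/2` — "Note that this clearly
  implies the total dissipation of Theorem 1.6": the `L²` norm is halved on infinitely many
  disjoint time blocks accumulating at `t = 1` and is non-increasing in between, so
  `‖Φ^{u_σ,ν}_{s,t} θ₀‖_{L²} → 0` as `t ↑ 1`; the flow `u_σ ∉ L¹([0,1], X)` is singular at `t = 1`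
  (p. 2), so `Φ^{u_σ,ν}_{s,1}` is this limit.

## Rendering (the tree's unit torus `T^d = UnitAddTorus d`, isotropic `νΔ`, any finite index type `d`)

* `‖Φ^{u,ν}_{s,t}‖_{L²₀→L²₀} ≤ 1/2` is `Rowan2024.HalvesNorm ν u s t`: every mean-zero `θ₀ ∈ L²`
  released at time `s` has `‖θ(t-s)‖²_{L²} ≤ ¼ ‖θ₀‖²_{L²}` for every weak solution `θ` of the problem
  with the time-shifted drift `u(s+·)` (`Torus.IsWeakScalarTransportOn T ν (u(s+·)) θ₀ θ`, any
  `T > t - s`) which is the `L²`-continuous representative on `[0,T)` (`Torus.IsL2ContinuousOn`;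
  for `ν > 0` and a locally bounded drift the weak solution is unique and `L²`-continuous, so this
  is the operator-norm statement).
* Definition 1.4 is typed in the equivalent `ε`–`ν₀` form `Rowan2024.IsRelaxationEnhancing`:
  for every `ε > 0` there is `ν₀ > 0` such that for all `ν ∈ (0,ν₀)` and `s ≥ 0` some
  `t ∈ [s, s + ε/ν]` has `‖Φ^{u,ν}_{s,t}‖ ≤ 1/2`. (`lim ν τ^u(ν) = 0` ⇒ for `ν < ν₀`, `ν τ^u(ν) < ε`,
  so every `inf` is `< ε/ν` and such a `t` exists; conversely the displayed property with `ε/2`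
  gives `τ^u(ν) ≤ ε/(2ν)`, i.e. `ν τ^u(ν) ≤ ε/2`.) No `sup`/`inf` over possibly empty sets is needed.
* Definition 1.5: `Rowan2024.accelerate σ u t x = σ'(t) u(σ(t), x)` with the one-sided derivative
  `derivWithin σ (Ici 0) t` (equal to `σ'(t)` on `(0,1)`); "smooth (increasing) diffeomorphism
  `σ : [0,1) → [0,∞)`" is `Rowan2024.IsAcceleration σ`: `σ(0) = 0`, `σ` strictly increasing and
  `C^∞` on `[0,1)` with `σ' > 0` there, and `σ(t) → ∞` as `t ↑ 1` (onto `[0,∞)`).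
* "`Φ^{u_σ,ν}_{s,1} θ₀ = 0`": the accelerated drift is not integrable up to `t = 1`, so a weak
  solution on `[0, 1-s)` (in the shifted clock) is a function which is a weak solution on `[0,T)`
  for EVERY `T < 1 - s` (the tree's class needs `u ∈ L¹(0,T; L²)`, true for `T < 1-s` only); the
  conclusion is that its `L²`-continuous representative has `‖θ(τ)‖²_{L²} → 0` as `τ ↑ 1 - s` —
  the meaning of the printed identity (see *Proof* above).
* `u ∈ L^∞_loc([0,∞) × T^d)`, `∇·u = 0`: a representative bounded on each `[0,T] × T^d`,
  space–time measurable, weakly divergence free at every `t ≥ 0` (only the a.e. class enters weak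
  solutions).

## Not typed here (with reasons)

* Theorem 1.7 (pp. 2–3): the weighted bound
  `‖ f⁻¹((1-t)/(4(|log₂(1-t)|+1))) / (2(|log₂(1-t)|+1)) · u_σ(t) ‖_{L^∞([0,1],X)} ≤ ‖u‖_{L^∞([0,∞),X)}`,
  `f(a) := sup_{0≤b≤a} b τ^u(b)`, for any Banach space `X` of functions, and its specialisation
  (1.3)–(1.4) to exponentially mixing `u ∈ L^∞([0,∞), C^∞(T^d))`
  (`(1-t)/(|log₂(1-t)|^{2+2/p}+1) · u_σ(t) ∈ L^∞([0,1], C^∞(T^d))`, via Coti Zelati–Delgadino–Elgindi's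
  `τ^u(ν) ≤ C|log ν|^{2/p}`): needs the generalised inverse of `f` and `L^∞_t C^∞_x` classes;
  quoted, typable on request.
* §2 remarks (total dissipation at fixed `ν > 0` is impossible for `u ∈ L^∞_{t,x}` by unique
  continuation [Poon 1996]; every mixing flow is relaxation enhancing [Feng–Iyer 2019,
  Coti Zelati–Delgadino–Elgindi 2020]): context, other sources.
-/

noncomputable section

namespace Literature.Analysis.FluidPDE

open _root_.MeasureTheory _root_.Set _root_.Filter
open scoped NNReal ENNReal Topology ContDiff

namespace Rowan2024

variable {d : Type*} [Fintype d]

/-- **`‖Φ^{u,ν}_{s,t}‖_{L²₀ → L²₀} ≤ 1/2`** (Def. 1.2–1.3) on the unit torus: every mean-zero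
`θ₀ ∈ L²(T^d)` released at time `s` under the drift `u` with diffusivity `ν` has lost half of its
`L²` norm by time `t` — for every weak solution `θ` of `∂_τ θ + u(s+τ)·∇θ = νΔθ`, `θ(0) = θ₀` on
`T^d × [0,T)` with `T > t - s` (the time-shifted drift; `Torus.IsWeakScalarTransportOn`) which is the
`L²`-continuous representative on `[0,T)`, `‖θ(t-s)‖²_{L²} ≤ ¼ ‖θ₀‖²_{L²}` (module docstring,
*Rendering*). [cite: Rowan2024, Def. 1.2–1.3 p. 1] -/
def HalvesNorm (ν : ℝ) (u : ℝ → UnitAddTorus d → EuclideanSpace ℝ d) (s t : ℝ) : Prop :=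
  ∀ θ₀ : UnitAddTorus d → ℝ, MemLp θ₀ 2 volume → ∫ x, θ₀ x = 0 →
    ∀ (T : ℝ) (θ : ℝ → UnitAddTorus d → ℝ), t - s < T →
      Torus.IsWeakScalarTransportOn T ν (fun τ => u (s + τ)) θ₀ θ →
      Torus.IsL2ContinuousOn (Ico 0 T) θ →
        Torus.scalarL2Sq (θ (t - s)) ≤ 1 / 4 * Torus.scalarL2Sq θ₀

/-- **Relaxation enhancing** (Def. 1.4, `lim_{ν→0} ν τ^u(ν) = 0` with the dissipation time
`τ^u(ν) = sup_{s≥0} inf{t - s : t ≥ s, ‖Φ^{u,ν}_{s,t}‖ ≤ 1/2}` of Def. 1.3), in the equivalent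
`ε`–`ν₀` form (module docstring, *Rendering*): for every `ε > 0` there is `ν₀ > 0` such that for all
`ν ∈ (0,ν₀)` and all `s ≥ 0` the `L²₀ → L²₀` norm of the solution operator from time `s` drops to
`1/2` by some time `t ∈ [s, s + ε/ν]`. The notion goes back to Constantin–Kiselev–Ryzhik–Zlatoš
(2008) ("We however use a different—but equivalent—definition", p. 1); every mixing flow is
relaxation enhancing (p. 3, citing Feng–Iyer and Coti Zelati–Delgadino–Elgindi). [cite: Rowan2024, Def. 1.3–1.4 p. 1] -/
def IsRelaxationEnhancing (u : ℝ → UnitAddTorus d → EuclideanSpace ℝ d) : Prop :=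
  ∀ ε : ℝ, 0 < ε → ∃ ν₀ : ℝ, 0 < ν₀ ∧ ∀ ν ∈ Ioo 0 ν₀, ∀ s : ℝ, 0 ≤ s →
    ∃ t : ℝ, s ≤ t ∧ t ≤ s + ε / ν ∧ HalvesNorm ν u s t

/-- **The accelerated flow** `u_σ(t,x) := σ'(t) u(σ(t), x)` of Def. 1.5 (`σ'` as the one-sided
derivative `derivWithin σ (Ici 0) t`, which is `σ'(t)` for `t ∈ (0,1)` and the right derivative at
`t = 0`): "if `θ` solves the transport equation associated to `u`, then `θ(σ(t),x)` solves the
transport equation associated to `u_σ`". [cite: Rowan2024, Def. 1.5 p. 2] -/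
def accelerate (σ : ℝ → ℝ) (u : ℝ → UnitAddTorus d → EuclideanSpace ℝ d) :
    ℝ → UnitAddTorus d → EuclideanSpace ℝ d :=
  fun t x => derivWithin σ (Ici 0) t • u (σ t) x

omit [Fintype d] in
/-- Unfolding `accelerate`. [cite: Rowan2024, Def. 1.5 p. 2] -/
theorem accelerate_apply (σ : ℝ → ℝ) (u : ℝ → UnitAddTorus d → EuclideanSpace ℝ d) (t : ℝ)
    (x : UnitAddTorus d) : accelerate σ u t x = derivWithin σ (Ici 0) t • u (σ t) x := rfl

/-- **A smooth increasing diffeomorphism `σ : [0,1) → [0,∞)`** (Def. 1.5, Thm. 1.6): `σ(0) = 0`,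
`σ` strictly increasing on `[0,1)`, `σ(t) → ∞` as `t ↑ 1` (so `σ` maps `[0,1)` onto `[0,∞)`),
`σ ∈ C^∞([0,1))` (one-sided at `0`) with `σ' > 0` on `[0,1)` (so the inverse is smooth). Values of
`σ` outside `[0,1)` are irrelevant. [cite: Rowan2024, Def. 1.5 and Thm. 1.6, p. 2] -/
def IsAcceleration (σ : ℝ → ℝ) : Prop :=
  σ 0 = 0 ∧ StrictMonoOn σ (Ico 0 1) ∧ Tendsto σ (𝓝[<] 1) atTop ∧
    ContDiffOn ℝ ∞ σ (Ico 0 1) ∧ ∀ t ∈ Ico (0 : ℝ) 1, 0 < derivWithin σ (Ici 0) t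

/-- **Total diffusivity of the accelerated flow on `[0,1]`** (the conclusion of Thm. 1.6 for a
given `σ`): for all `ν > 0`, all release times `s ∈ [0,1)` and all mean-zero `θ₀ ∈ L²(T^d)`,
`Φ^{u_σ,ν}_{s,1} θ₀ = 0` — rendered (module docstring, *Rendering*): every `θ` which, in the clock
started at `s`, is a weak solution of `∂_τ θ + u_σ(s+τ)·∇θ = νΔθ`, `θ(0) = θ₀` on `T^d × [0,T)` for
EVERY `T ∈ (0, 1-s)` and is the `L²`-continuous representative on `[0, 1-s)`, satisfies
`‖θ(τ)‖²_{L²} → 0` as `τ ↑ 1 - s`. [cite: Rowan2024, Thm. 1.6 p. 2; §3 p. 4] -/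
def IsTotallyDiffusive (σ : ℝ → ℝ) (u : ℝ → UnitAddTorus d → EuclideanSpace ℝ d) : Prop :=
  ∀ ν : ℝ, 0 < ν → ∀ s ∈ Ico (0 : ℝ) 1,
    ∀ θ₀ : UnitAddTorus d → ℝ, MemLp θ₀ 2 volume → ∫ x, θ₀ x = 0 →
      ∀ θ : ℝ → UnitAddTorus d → ℝ,
        (∀ T : ℝ, 0 < T → T < 1 - s →
          Torus.IsWeakScalarTransportOn T ν (fun τ => accelerate σ u (s + τ)) θ₀ θ) →
        Torus.IsL2ContinuousOn (Ico 0 (1 - s)) θ →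
          Tendsto (fun τ => Torus.scalarL2Sq (θ τ)) (𝓝[<] (1 - s)) (𝓝 0)

end Rowan2024

variable {d : Type*} [Fintype d]

/-- **Rowan 2024, Theorem 1.6 (accelerated relaxation-enhancing flows cause total dissipation)**, on
the unit torus `T^d` (any finite index type `d`): let `u ∈ L^∞_loc([0,∞) × T^d)` (space–time
measurable, bounded on every `[0,T] × T^d`) be divergence free (weakly, at every `t ≥ 0`) and
relaxation enhancing (`Rowan2024.IsRelaxationEnhancing u`, Def. 1.3–1.4). Then some acceleration
`u_σ(t,x) = σ'(t) u(σ(t),x)` (`Rowan2024.accelerate σ u`, Def. 1.5) by a smooth increasing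
diffeomorphism `σ : [0,1) → [0,∞)` (`Rowan2024.IsAcceleration σ`) is totally diffusive on `[0,1]`
for ALL diffusivities: for all `ν > 0`, `s ∈ [0,1)`, mean-zero `θ₀ ∈ L²`, `Φ^{u_σ,ν}_{s,1} θ₀ = 0`
(`Rowan2024.IsTotallyDiffusive σ u`; the flow is singular at `t = 1`, `u_σ ∉ L¹([0,1],X)`, and the
identity is the vanishing of the `L²` norm as `t ↑ 1`, module docstring *Rendering*). Source form
quoted in the module docstring. [cite: Rowan2024, Thm. 1.6 p. 2 (with Def. 1.2–1.5 pp. 1–2; proof §3 p. 4)] -/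
def Rowan2024_thm16 : Prop :=
  ∀ u : ℝ → UnitAddTorus d → EuclideanSpace ℝ d,
    AEStronglyMeasurable (FunctionSpaces.Torus.stLift u) volume →
    (∀ T : ℝ, ∃ A : ℝ, ∀ t ∈ Icc (0 : ℝ) T, ∀ x : UnitAddTorus d, ‖u t x‖ ≤ A) →
    (∀ t : ℝ, 0 ≤ t → FunctionSpaces.Torus.IsWeaklyDivFree (u t)) →
    Rowan2024.IsRelaxationEnhancing u →
      ∃ σ : ℝ → ℝ, Rowan2024.IsAcceleration σ ∧ Rowan2024.IsTotallyDiffusive σ u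

end Literature.Analysis.FluidPDE

end
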